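import Summits.ResolutionOfSingularities.ResolutionOfSingularities.Theorems.HomologicalConductorNoZenoBirthDefs
import Summits.ResolutionOfSingularities.ResolutionOfSingularities.Theorems.HomologicalConductorNoZenoNoetherianCase
import Summits.ResolutionOfSingularities.ResolutionOfSingularities.Theorems.HomologicalConductorNoZenoDim2RegularCentre
import Summits.ResolutionOfSingularities.ResolutionOfSingularities.Theorems.HomologicalConductorSurfaceTerminationRegimes
import Summits.ResolutionOfSingularities.ResolutionOfSingularities.Theorems.SyzygyFlatteningHigherRankTerminationLocAt
import Literature.AlgebraicGeometry.Resolution.LocalUniformization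
import Literature.AlgebraicGeometry.Resolution.AbhyankarValuationsLocalUniformization
import HarnessLib

/-!
# Crux `NoZeno` (stmt-ResolutionOfSingularities-16483), line `birth` v6: exhausted towers are eventually sandwiched

Registered stub `stub_kernelRankOneSurface` (skeleton v6) carries the hypothesis that the
canonical normalised `ca`-tower `T_m = tower O A m` EXHAUSTS the valuation ring `O`
(`∀ x ∈ O, ∃ m, x ∈ T_m`; supplied in transcendence degree 2 by
`Theorems/HomologicalConductorNoZenoDim2Exhaustion.lean`, p460241). This file records the
structural consequence that turns the stub into a statement about SANDWICHED stages:

* `exh_le_tower_of_fg` — an exhausting tower eventually contains every finitely generated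
  `B ⊆ O`, hence its local ring `loc O B` at the centre of `O` (cofinality).
* `exh_exists_regular_le_tower_of_isLocallyUniformizable` — if moreover `O` is locally
  uniformizable over `k` (some affine model of `K` inside `O` is regular at the centre of `O`:
  `Literature.AlgebraicGeometry.Resolution.IsLocallyUniformizable`), then there is a REGULAR local
  `k`-subalgebra `R ⊆ O`, `R = loc O R`, `Frac R = K`, contained in — and then dominated by — every
  late stage `T_m`, `m ≥ m₀`: the late stages are normal local domains essentially of finite type
  birationally dominating one fixed regular local ring ("sandwiched" position).
* `exh_exists_regular_le_tower_of_transcendenceDefect_eq_zero` — unconditionally so for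
  Abhyankar places (`E + F = tr.deg`) over a perfect ground field, by the tree's
  `isLocallyUniformizable_of_transcendenceDefect_eq_zero` (Knaf–Kuhlmann 2005 / Temkin 2013).

In the surface case (`tr.deg_k K = 2`, `O` rank one non-discrete, zero-dimensional) the
rational-rank-two valuations are Abhyankar places; the rational-rank-one non-discrete ones have
transcendence defect 1, where local uniformization is classical for surfaces (Abhyankar 1956,
Lipman 1978) but enters the tree only as a named fact (`CossartPiltant2019LU3`, `Temkin2013`).

References: S. S. Abhyankar, *Local uniformization on algebraic surfaces over ground fields of
characteristic p ≠ 0*, Ann. of Math. 63 (1956); F.-V. Kuhlmann, H. Knaf, *Abhyankar places admit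
local uniformization in any characteristic*, Ann. Sci. ÉNS 38 (2005), Thm. 1.1
[`KnafKuhlmann2005`]; O. Zariski, P. Samuel, *Commutative Algebra* II, VI §5 [`ZariskiSamuel1960`].
-/

noncomputable section

-- single-problem summit: the doubled namespace component `ResolutionOfSingularities` is forced
set_option linter.dupNamespace false

namespace Summit.ResolutionOfSingularities.ResolutionOfSingularities.Theorems.NoZeno.Birth

open Summit.ResolutionOfSingularities.ResolutionOfSingularities.Theses.HomologicalConductor
open Literature.AlgebraicGeometry.Resolution IsLocalRing

variable {k K : Type} [Field k] [Field K] [Algebra k K]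

/-- **Cofinality of an exhausting tower.** If every element of `O` lies in some stage, then every
finitely generated `B ⊆ O` lies in all late stages, and so does its local ring `loc O B` at the
centre of `O` (stages are their own localisation at the centre, `loc O T_m = T_m`).
[cite: ZariskiSamuel1960, VI §5] -/
theorem exh_le_tower_of_fg (O : ValuationSubring K) (A : Subalgebra k K)
    (hk : ∀ c : k, algebraMap k K c ∈ O) (hAO : A.toSubring ≤ O.toSubring)
    (hexh : ∀ x : K, x ∈ O → ∃ m : ℕ, x ∈ tower O A m) (B : Subalgebra k K) (hB : B.FG)
    (hBO : B.toSubring ≤ O.toSubring) :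
    ∃ m₀ : ℕ, ∀ m : ℕ, m₀ ≤ m → B ≤ tower O A m ∧ loc O B ≤ tower O A m := by
  classical
  obtain ⟨F, hF⟩ := hB
  have hFB : ∀ f ∈ F, f ∈ B := fun f hf => hF ▸ Algebra.subset_adjoin hf
  choose! g hg using fun f (hf : f ∈ F) => hexh f (hBO (hFB f hf))
  refine ⟨F.sup g, fun m hm => ?_⟩
  have hBT : B ≤ tower O A m := by
    rw [← hF]
    refine Algebra.adjoin_le fun f hf => ?_
    exact d2rc_mem_tower_of_le O A ((Finset.le_sup hf).trans hm) (hg f hf)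
  refine ⟨hBT, ?_⟩
  have h : loc O B ≤ loc O (tower O A m) := by
    rw [loc_eq_locAt, loc_eq_locAt]
    exact SyzygyFlattening.locAt_mono O hBT
  rw [SurfaceTermination.Regimes.loc_tower O A hk hAO m] at h
  exact h

/-- **Exhausted towers are eventually sandwiched (given local uniformization).** If the tower
along `O` exhausts `O` and `O` is locally uniformizable over `k`, there is a REGULAR local
`k`-subalgebra `R ⊆ O` with `Frac R = K`, equal to its own localisation at the centre of `O`
(so dominated by `O`), which lies in every late stage `T_m`, `m ≥ m₀`. Take `R = loc O A'` for a
uniformizing model `A'`: it is regular (`SyzygyFlattening.isRegularLocalRing_locAt_iff_atPrime`)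
and cofinality applies to `A'`. [cite: ZariskiSamuel1960, VI §5] -/
theorem exh_exists_regular_le_tower_of_isLocallyUniformizable (O : ValuationSubring K)
    (A : Subalgebra k K) (hk : ∀ c : k, algebraMap k K c ∈ O) (hAO : A.toSubring ≤ O.toSubring)
    (hexh : ∀ x : K, x ∈ O → ∃ m : ℕ, x ∈ tower O A m) (hLU : IsLocallyUniformizable k K O) :
    ∃ R : Subalgebra k K, IsRegularLocalRing ↥R ∧ IsFractionRing ↥R K ∧
      R.toSubring ≤ O.toSubring ∧ loc O R = R ∧
      ∃ m₀ : ℕ, ∀ m : ℕ, m₀ ≤ m → R ≤ tower O A m := by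
  obtain ⟨A', hA'O, hA'fg, hA'fr, hreg⟩ := hLU
  haveI := hA'fr
  refine ⟨loc O A', ?_, ?_, ?_, ?_, ?_⟩
  · rw [loc_eq_locAt]
    exact (SyzygyFlattening.isRegularLocalRing_locAt_iff_atPrime O A' hA'O).mpr hreg
  · rw [loc_eq_locAt]
    exact isFractionRing_subalgebra_of_le A' _ (SyzygyFlattening.self_le_locAt O A')
  · rw [loc_eq_locAt]
    exact SyzygyFlattening.locAt_toSubring_le O hk hA'O
  · rw [loc_eq_locAt]
    exact SyzygyFlattening.locAt_locAt O A' hA'O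
  · obtain ⟨m₀, hm₀⟩ := exh_le_tower_of_fg O A hk hAO hexh A' hA'fg hA'O
    exact ⟨m₀, fun m hm => (hm₀ m hm).2⟩

/-- **Unconditional form for Abhyankar places over a perfect ground field.** If `k` is perfect,
`K/k` finitely generated (here: `K = Frac A`, `A` finitely generated), `O ∋ k` has transcendence
defect `0` (`E + F = tr.deg_k K`) and the tower exhausts `O`, then a regular local ring
`R ⊆ O` with `Frac R = K`, `loc O R = R`, lies in every late stage.
[cite: KnafKuhlmann2005, Thm. 1.1] -/
theorem exh_exists_regular_le_tower_of_transcendenceDefect_eq_zero [PerfectField k]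
    (O : ValuationSubring K) (A : Subalgebra k K) (hk : ∀ c : k, algebraMap k K c ∈ O)
    (hA : A.FG) (hfr : IsFractionRing ↥A K) (hAO : A.toSubring ≤ O.toSubring)
    (hexh : ∀ x : K, x ∈ O → ∃ m : ℕ, x ∈ tower O A m)
    (hdef : transcendenceDefect k O hk = 0) :
    ∃ R : Subalgebra k K, IsRegularLocalRing ↥R ∧ IsFractionRing ↥R K ∧
      R.toSubring ≤ O.toSubring ∧ loc O R = R ∧
      ∃ m₀ : ℕ, ∀ m : ℕ, m₀ ≤ m → R ≤ tower O A m := by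
  haveI := hfr
  haveI : Algebra.FiniteType k ↥A := A.fg_iff_finiteType.mp hA
  have hfg : (⊤ : IntermediateField k K).FG :=
    IntermediateField.fg_top_of_isFractionRing_of_finiteType k ↥A K
  exact exh_exists_regular_le_tower_of_isLocallyUniformizable O A hk hAO hexh
    (isLocallyUniformizable_of_transcendenceDefect_eq_zero hfg O hk hdef)

end Summit.ResolutionOfSingularities.ResolutionOfSingularities.Theorems.NoZeno.Birth

end
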